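import Mathlib
import Summits.NavierStokesRegularity.FluidComputer.AbcInertiaEigenvalues
import Summits.NavierStokesRegularity.FluidComputer.AbcClassIIBases

/-!
# INERTIA-3L instantiation, Part 8: ARBITRARY real orthonormal orbit bases — the certificate facts (R1)(R2)
# may be stated in the certifier's OWN basis (instab3 g8, cell `ns-blowup`, 2026-08-27)

HONEST FRAMING (human ruling D-0035): nothing here is a claim about Navier–Stokes blow-up.
WHAT THIS IS NOT: not NS evidence. MODEL lane (forced-ABC linearisation, class II); no certificate, number
or census word moves.

`AbcInertiaCount` / `AbcInertiaEigenvalues` state (R1)(R2) about matrices built from instab4's EXISTENTIAL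
orbit-adapted basis `bfam` (`orbitBasis O := stdOrthonormalBasis`), in which no program computes. As instab4 g7
did for the X0 chain (`AbcClassIIBases`), this file transfers the hypotheses to an ARBITRARY family
`e O : OrthonormalBasis (Fin (odim O)) ℝ (realSpace O)` of real orthonormal bases of the class-II orbit spaces
(basis families `bf i = extend O_i (e O_i i.2)`, first-order matrix `am i j = Re Σ_k ⟪bf i k, Π_k X(bf j)(k)⟫`):
**`card_classII_eigenfunctions_le_of_inertia_certificate_of_bases`** — (R1)(R2) for the matrices
`Â' = [(−|O|²/R − a)δ + am]_{HH}`, `F₂' = GH'·am_{HB} + am_{BH}ᵀ`, a symmetric head weight `GH'` and `V'`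
IN THE BASES `e`, plus (R3), imply: at most `m` pairwise distinct classical class-II eigenvalues with
`Re z ≥ a` (the conclusion is basis-free). Proof: the per-orbit orthogonal change-of-basis kernel
`Q i j = Re Σ_k ⟪bfam i k, bf j k⟫` (`AbcClassIIBasesPrep/Bases`: `Q_Tᵀ Q_T = 1 = Q_T Q_Tᵀ` on the
orbit-saturated index sets `H`, `B`; `section_conj_sq`, `section_conj_offdiag`; `coefQ_comm_diag` for the
orbit-constant tail constants `E`) conjugates `Â, am_{HB}, am_{BH}`; with `GH := Q_H GH' Q_Hᵀ`,
`V := Q_H V'` one gets `𝓜' = Q_Hᵀ 𝓜 Q_H` and `GH' + V'V'ᵀ = Q_Hᵀ (GH + VVᵀ) Q_H`, so (R1)(R2) transfer.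
Hence the AUDIT-BASIS clause of an INERTIA-3L cell reads exactly as for X0 (KERNEL-CHAIN §6): «per orbit of
`|O|² ≤ (r_H+1)²`, the certifier's vectors are transversal, class II, conjugate-symmetric, real-orthonormal and
`odim O` in number».

Mathlib + `AbcInertiaEigenvalues` + `AbcClassIIBases`; no new definitions; std axioms. [folklore]
-/

noncomputable section

open scoped BigOperators ComplexConjugate Matrix
open Finset Matrix MeasureTheory UnitAddTorus

namespace Summit.NavierStokesRegularity.FluidComputer.AbcInertia

open Literature.Analysis.FunctionSpaces Literature.Analysis.FunctionSpaces.Torus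
open Literature.Analysis.FluidPDE
open Summit.NavierStokesRegularity.FluidComputer.AbcClassII

section Bases

variable (e : ∀ O : Orbit, OrthonormalBasis (Fin (odim O)) ℝ (realSpace O.1))
variable (bf : Idx → Fam)
variable (hbf : ∀ i : Idx, bf i = extend i.1.1 ((e i.1 i.2 : realSpace i.1.1) : EuclideanSpace ℂ (↥i.1.1 × Fin 3)))
variable (am : Idx → Idx → ℝ)
variable (ham : ∀ i j : Idx, am i j =
  (∑ k ∈ i.1.1, (inner ℂ (bf i k) (Torus.lerayCoeff k (crossForm 1 1 1 (bf j) k)) : ℂ)).re)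

/-- An index set characterised by the orbit norm is orbit-saturated. -/
theorem saturated_of_mem_iff {T : Finset Idx} {P : ℝ → Prop} (hT : ∀ i : Idx, i ∈ T ↔ P (onormSq i.1)) :
    ∀ i ∈ T, ∀ a : Fin (odim i.1), (⟨i.1, a⟩ : Idx) ∈ T := by
  intro i hi a
  exact (hT ⟨i.1, a⟩).mpr ((hT i).mp hi)

/-- `x ⬝ ((Q N Qᵀ) x) = (Qᵀ x) ⬝ (N (Qᵀ x))`. -/
theorem dotProduct_conj_mulVec {n k : Type*} [Fintype n] [Fintype k] (Q : Matrix n k ℝ) (N : Matrix k k ℝ)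
    (x : n → ℝ) : x ⬝ᵥ ((Q * N * Qᵀ) *ᵥ x) = (Qᵀ *ᵥ x) ⬝ᵥ (N *ᵥ (Qᵀ *ᵥ x)) := by
  rw [← Matrix.mulVec_mulVec, ← Matrix.mulVec_mulVec, Matrix.dotProduct_mulVec, ← Matrix.mulVec_transpose]

/-- `(Qᵀ x) ⬝ ((Qᵀ N Q)(Qᵀ x)) = x ⬝ (N x)` for `Q Qᵀ = 1`. -/
theorem conj_form_eq {n : Type*} [Fintype n] [DecidableEq n] (Q N : Matrix n n ℝ) (hQ : Q * Qᵀ = 1)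
    (x : n → ℝ) : (Qᵀ *ᵥ x) ⬝ᵥ ((Qᵀ * N * Q) *ᵥ (Qᵀ *ᵥ x)) = x ⬝ᵥ (N *ᵥ x) := by
  have h1 : (Qᵀ * N * Q) *ᵥ (Qᵀ *ᵥ x) = Qᵀ *ᵥ (N *ᵥ x) := by
    rw [Matrix.mulVec_mulVec, Matrix.mul_assoc (Qᵀ * N) Q Qᵀ, hQ, Matrix.mul_one, ← Matrix.mulVec_mulVec]
  rw [h1, AbcClassII.dotProduct_transpose_mulVec Q hQ]

include hbf ham in
/-- **INERTIA-3L, END TO END, IN ARBITRARY ORBIT BASES (class II, classical form).** For any family `e` of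
real orthonormal bases of the class-II orbit spaces: (R1)(R2) for the matrices in the bases `e` (first-order
matrix `am`, head weight `GH'`, `V'`) and (R3) ⇒ at most `m` pairwise distinct classical class-II eigenvalues
`z` of the linearisation about `abcFlow 1 1 1` at viscosity `1/(2πR)` with `Re z ≥ a`. -/
theorem card_classII_eigenfunctions_le_of_inertia_certificate_of_bases {R a rL rH : ℝ} {HL HH HB : Finset Idx}
    {m : ℕ} (hR : 0 < R) (h0 : 0 ≤ rL) (hLH : rL + 1 ≤ rH)
    (hHL : ∀ i : Idx, i ∈ HL ↔ onormSq i.1 ≤ rL ^ 2)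
    (hHH : ∀ i : Idx, i ∈ HH ↔ onormSq i.1 ≤ rH ^ 2)
    (hHB : ∀ i : Idx, i ∈ HB ↔ rH ^ 2 < onormSq i.1 ∧ onormSq i.1 ≤ (rH + 1) ^ 2)
    (GH' Ah' : Matrix ↥HH ↥HH ℝ) (AHB' : Matrix ↥HH ↥HB ℝ) (ABH' : Matrix ↥HB ↥HH ℝ) (E : ↥HB → ℝ)
    (V' : Matrix ↥HH (Fin m) ℝ) (hGH' : GH'ᵀ = GH')
    (hAh' : Ah' = Matrix.of fun i j : ↥HH => (if i = j then -(onormSq i.1.1 / R) - a else 0) + am i.1 j.1)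
    (hAHB' : AHB' = Matrix.of fun (i : ↥HH) (l : ↥HB) => am i.1 l.1)
    (hABH' : ABH' = Matrix.of fun (l : ↥HB) (i : ↥HH) => am l.1 i.1)
    (hE : E = fun l : ↥HB => onormSq l.1.1 / R + a - Real.sqrt 2)
    (hR1' : ∀ x : ↥HH → ℝ, x ≠ 0 →
      x ⬝ᵥ ((GH' * Ah' + Ah'ᵀ * GH' + (1 / 2 : ℝ) • ((GH' * AHB' + ABH'ᵀ) * Matrix.diagonal (fun l => (E l)⁻¹) *
        (GH' * AHB' + ABH'ᵀ)ᵀ)) *ᵥ x) < 0)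
    (hR2' : ∀ x : ↥HH → ℝ, 0 ≤ x ⬝ᵥ ((GH' + V' * V'ᵀ) *ᵥ x))
    (hR3 : Real.sqrt 2 < ((⌊rH ^ 2⌋₊ : ℝ) + 1) / R + a)
    {n : ℕ} (z : Fin n → ℂ) (hz : Function.Injective z)
    (u : Fin n → UnitAddTorus (Fin 3) → EuclideanSpace ℂ (Fin 3))
    (hu : ∀ k, Torus.LinNSResolventRel (1 / (2 * Real.pi * R)) (Torus.abcFlow 1 1 1) (2 * Real.pi * z k) (u k) 0)
    (hu0 : ∀ k, u k ≠ 0) (hII : ∀ k, IsClassII (mFourierCoeff (u k))) (hre : ∀ k, a ≤ (z k).re) :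
    n ≤ m := by
  classical
  -- saturation and disjointness of the index sets
  have hsH : ∀ i ∈ HH, ∀ c : Fin (odim i.1), (⟨i.1, c⟩ : Idx) ∈ HH :=
    saturated_of_mem_iff (P := fun q => q ≤ rH ^ 2) hHH
  have hsB : ∀ i ∈ HB, ∀ c : Fin (odim i.1), (⟨i.1, c⟩ : Idx) ∈ HB :=
    saturated_of_mem_iff (P := fun q => rH ^ 2 < q ∧ q ≤ (rH + 1) ^ 2) hHB
  have hdis : Disjoint HH HB := disjoint_HH_HB hHH hHB
  -- the change-of-basis matrices
  set QH : Matrix ↥HH ↥HH ℝ :=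
    Matrix.of fun i j : ↥HH => (∑ k ∈ (i : Idx).1.1, (inner ℂ (bfam i k) (bf j k) : ℂ)).re with hQH
  set QB : Matrix ↥HB ↥HB ℝ :=
    Matrix.of fun i j : ↥HB => (∑ k ∈ (i : Idx).1.1, (inner ℂ (bfam i k) (bf j k) : ℂ)).re with hQB
  have hQH1 : QHᵀ * QH = 1 := coefQ_transpose_mul_self e bf hbf hsH
  have hQH2 : QH * QHᵀ = 1 := coefQ_mul_transpose_self e bf hbf hsH
  have hQB1 : QBᵀ * QB = 1 := coefQ_transpose_mul_self e bf hbf hsB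
  have hQB2 : QB * QBᵀ = 1 := coefQ_mul_transpose_self e bf hbf hsB
  -- the matrices in the basis `bfam`
  set Ah : Matrix ↥HH ↥HH ℝ :=
    Matrix.of fun i j : ↥HH => (if i = j then -(onormSq i.1.1 / R) - a else 0) + amat i.1 j.1 with hAh
  set AHB : Matrix ↥HH ↥HB ℝ := Matrix.of fun (i : ↥HH) (l : ↥HB) => amat i.1 l.1 with hAHB
  set ABH : Matrix ↥HB ↥HH ℝ := Matrix.of fun (l : ↥HB) (i : ↥HH) => amat l.1 i.1 with hABH
  set GH : Matrix ↥HH ↥HH ℝ := QH * GH' * QHᵀ with hGH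
  set V : Matrix ↥HH (Fin m) ℝ := QH * V' with hV
  -- (ii) `Ah' = QHᵀ Ah QH` (from `section_conj_sq` at `x = a`: `Ah = −S(a)`)
  have hSa : Ah = -(Matrix.of fun i j : ↥HH =>
      (if (i : Idx) = j then a + onormSq (j : Idx).1 / R else 0) - amat i j) := by
    ext i j
    simp only [hAh, Matrix.of_apply, Matrix.neg_apply]
    by_cases h : i = j
    · subst h; simp; ring
    · rw [if_neg h, if_neg fun h' => h (Subtype.ext h')]; ring
  have hSa' : Ah' = -(Matrix.of fun i j : ↥HH =>
      (if (i : Idx) = j then a + onormSq (j : Idx).1 / R else 0) - am i j) := by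
    ext i j
    simp only [hAh', Matrix.of_apply, Matrix.neg_apply]
    by_cases h : i = j
    · subst h; simp; ring
    · rw [if_neg h, if_neg fun h' => h (Subtype.ext h')]; ring
  have hcA : Ah' = QHᵀ * Ah * QH := by
    rw [hSa', hSa, section_conj_sq e bf hbf am ham hsH R a, Matrix.mul_neg, Matrix.neg_mul]
  -- (iii) the off-diagonal blocks
  have hcHB : AHB' = QHᵀ * AHB * QB := by
    have h := section_conj_offdiag e bf hbf am ham hsH hsB hdis R a
    have hne : ∀ (i : ↥HH) (l : ↥HB), (i : Idx) ≠ l := fun i l h' =>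
      Finset.disjoint_left.mp hdis i.2 (h' ▸ l.2)
    have e1 : (Matrix.of fun (i : ↥HH) (l : ↥HB) =>
        (if (i : Idx) = l then a + onormSq (l : Idx).1 / R else 0) - am i l) = -AHB' := by
      ext i l; simp [hAHB', if_neg (hne i l)]
    have e2 : (Matrix.of fun (i : ↥HH) (l : ↥HB) =>
        (if (i : Idx) = l then a + onormSq (l : Idx).1 / R else 0) - amat i l) = -AHB := by
      ext i l; simp [hAHB, if_neg (hne i l)]
    rw [e1, e2, Matrix.mul_neg, Matrix.neg_mul] at h
    exact neg_injective h
  have hcBH : ABH' = QBᵀ * ABH * QH := by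
    have h := section_conj_offdiag e bf hbf am ham hsB hsH hdis.symm R a
    have hne : ∀ (l : ↥HB) (i : ↥HH), (l : Idx) ≠ i := fun l i h' =>
      Finset.disjoint_left.mp hdis i.2 (h' ▸ l.2)
    have e1 : (Matrix.of fun (l : ↥HB) (i : ↥HH) =>
        (if (l : Idx) = i then a + onormSq (i : Idx).1 / R else 0) - am l i) = -ABH' := by
      ext l i; simp [hABH', if_neg (hne l i)]
    have e2 : (Matrix.of fun (l : ↥HB) (i : ↥HH) =>
        (if (l : Idx) = i then a + onormSq (i : Idx).1 / R else 0) - amat l i) = -ABH := by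
      ext l i; simp [hABH, if_neg (hne l i)]
    rw [e1, e2, Matrix.mul_neg, Matrix.neg_mul] at h
    exact neg_injective h
  -- (iv) the tail constants commute with `QB`
  have hDQ : Matrix.diagonal (fun l : ↥HB => (E l)⁻¹) * QB = QB * Matrix.diagonal (fun l : ↥HB => (E l)⁻¹) := by
    ext l l'
    rw [Matrix.diagonal_mul, Matrix.mul_diagonal]
    simp only [hQB, Matrix.of_apply, hE]
    exact coefQ_comm_diag e bf hbf (fun i : Idx => (onormSq i.1 / R + a - Real.sqrt 2)⁻¹)
      (fun i j h => by simp only [h]) l l'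
  -- (v) `GH' = QHᵀ GH QH`, and the conjugation of `𝓜`
  have hGHc : QHᵀ * GH * QH = GH' := by
    rw [hGH]
    calc QHᵀ * (QH * GH' * QHᵀ) * QH = (QHᵀ * QH) * GH' * (QHᵀ * QH) := by
          simp only [Matrix.mul_assoc]
      _ = GH' := by rw [hQH1, Matrix.one_mul, Matrix.mul_one]
  have hGHsymm : GHᵀ = GH := by
    rw [hGH, Matrix.transpose_mul, Matrix.transpose_mul, Matrix.transpose_transpose, hGH', Matrix.mul_assoc]
  have hM0 : GH' * Ah' + Ah'ᵀ * GH' = QHᵀ * (GH * Ah + Ahᵀ * GH) * QH := by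
    rw [← hGHc, hcA]
    have e1 : QHᵀ * GH * QH * (QHᵀ * Ah * QH) = QHᵀ * (GH * Ah) * QH := by
      calc QHᵀ * GH * QH * (QHᵀ * Ah * QH) = QHᵀ * GH * (QH * QHᵀ) * Ah * QH := by
            simp only [Matrix.mul_assoc]
        _ = QHᵀ * (GH * Ah) * QH := by rw [hQH2, Matrix.mul_one]; simp only [Matrix.mul_assoc]
    have e2 : (QHᵀ * Ah * QH)ᵀ * (QHᵀ * GH * QH) = QHᵀ * (Ahᵀ * GH) * QH := by
      rw [Matrix.transpose_mul, Matrix.transpose_mul, Matrix.transpose_transpose]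
      calc QHᵀ * (Ahᵀ * QHᵀᵀ) * (QHᵀ * GH * QH) = QHᵀ * Ahᵀ * (QH * QHᵀ) * GH * QH := by
            rw [Matrix.transpose_transpose]; simp only [Matrix.mul_assoc]
        _ = QHᵀ * (Ahᵀ * GH) * QH := by rw [hQH2, Matrix.mul_one]; simp only [Matrix.mul_assoc]
    rw [e1, e2, Matrix.mul_add, Matrix.add_mul]
  have hF2 : GH' * AHB' + ABH'ᵀ = QHᵀ * (GH * AHB + ABHᵀ) * QB := by
    rw [← hGHc, hcHB, hcBH]
    have e1 : QHᵀ * GH * QH * (QHᵀ * AHB * QB) = QHᵀ * (GH * AHB) * QB := by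
      calc QHᵀ * GH * QH * (QHᵀ * AHB * QB) = QHᵀ * GH * (QH * QHᵀ) * AHB * QB := by
            simp only [Matrix.mul_assoc]
        _ = QHᵀ * (GH * AHB) * QB := by rw [hQH2, Matrix.mul_one]; simp only [Matrix.mul_assoc]
    have e2 : (QBᵀ * ABH * QH)ᵀ = QHᵀ * ABHᵀ * QB := by
      rw [Matrix.transpose_mul, Matrix.transpose_mul, Matrix.transpose_transpose, Matrix.mul_assoc]
    rw [e1, e2, Matrix.mul_add, Matrix.add_mul]
  have hM : GH' * Ah' + Ah'ᵀ * GH' + (1 / 2 : ℝ) • ((GH' * AHB' + ABH'ᵀ) * Matrix.diagonal (fun l => (E l)⁻¹) *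
      (GH' * AHB' + ABH'ᵀ)ᵀ) =
      QHᵀ * (GH * Ah + Ahᵀ * GH + (1 / 2 : ℝ) • ((GH * AHB + ABHᵀ) * Matrix.diagonal (fun l => (E l)⁻¹) *
        (GH * AHB + ABHᵀ)ᵀ)) * QH := by
    rw [hM0, hF2]
    have e3 : QHᵀ * (GH * AHB + ABHᵀ) * QB * Matrix.diagonal (fun l => (E l)⁻¹) * (QHᵀ * (GH * AHB + ABHᵀ) * QB)ᵀ =
        QHᵀ * ((GH * AHB + ABHᵀ) * Matrix.diagonal (fun l => (E l)⁻¹) * (GH * AHB + ABHᵀ)ᵀ) * QH := by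
      rw [Matrix.transpose_mul, Matrix.transpose_mul, Matrix.transpose_transpose]
      calc QHᵀ * (GH * AHB + ABHᵀ) * QB * Matrix.diagonal (fun l => (E l)⁻¹) * (QBᵀ * ((GH * AHB + ABHᵀ)ᵀ * QHᵀᵀ))
          = QHᵀ * (GH * AHB + ABHᵀ) * (QB * Matrix.diagonal (fun l => (E l)⁻¹) * QBᵀ) *
              ((GH * AHB + ABHᵀ)ᵀ * QH) := by
            rw [Matrix.transpose_transpose]; simp only [Matrix.mul_assoc]
        _ = QHᵀ * ((GH * AHB + ABHᵀ) * Matrix.diagonal (fun l => (E l)⁻¹) * (GH * AHB + ABHᵀ)ᵀ) * QH := by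
            rw [← hDQ, Matrix.mul_assoc (Matrix.diagonal _) QB QBᵀ, hQB2, Matrix.mul_one]
            simp only [Matrix.mul_assoc]
    rw [e3]
    simp only [Matrix.mul_add, Matrix.add_mul, Matrix.mul_smul, Matrix.smul_mul, Matrix.mul_assoc]
  -- (vi) (R1) transfers
  have hR1 : ∀ x : ↥HH → ℝ, x ≠ 0 →
      x ⬝ᵥ ((GH * Ah + Ahᵀ * GH + (1 / 2 : ℝ) • ((GH * AHB + ABHᵀ) * Matrix.diagonal (fun l => (E l)⁻¹) *
        (GH * AHB + ABHᵀ)ᵀ)) *ᵥ x) < 0 := by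
    intro x hx
    have hx' : QHᵀ *ᵥ x ≠ 0 := by
      intro h
      apply hx
      have := congrArg (fun v => QH *ᵥ v) h
      rwa [Matrix.mulVec_mulVec, hQH2, Matrix.one_mulVec, Matrix.mulVec_zero] at this
    have key := hR1' (QHᵀ *ᵥ x) hx'
    rw [hM, conj_form_eq QH _ hQH2] at key
    exact key
  -- (vii) (R2) transfers
  have hR2 : ∀ x : ↥HH → ℝ, 0 ≤ x ⬝ᵥ ((GH + V * Vᵀ) *ᵥ x) := by
    intro x
    have e1 : GH + V * Vᵀ = QH * (GH' + V' * V'ᵀ) * QHᵀ := by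
      rw [hGH, hV, Matrix.transpose_mul, Matrix.mul_add, Matrix.add_mul]
      simp only [Matrix.mul_assoc]
    rw [e1, dotProduct_conj_mulVec]
    exact hR2' _
  exact card_classII_eigenfunctions_le_of_inertia_certificate hR h0 hLH hHL hHH hHB GH Ah AHB ABH E V hGHsymm
    hAh hAHB hABH hE hR1 hR2 hR3 z hz u hu hu0 hII hre

end Bases

end Summit.NavierStokesRegularity.FluidComputer.AbcInertia

end
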